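import Mathlib
import Literature.Probability.Percolation.DiagonalStripNCSuccessor
import HarnessLib

/-!
# A non-crossing connectivity is determined by its block minima and maxima

Topic `Literature/Probability/Percolation`. For a non-crossing equivalence relation `s` on the sites
`0, …, n-1` (`NCState n`) with cyclic successor `nxt` and predecessor `prd`
(`DiagonalStripNCSuccessor`), the **block maxima** are the sites `p` with `nxt p ≤ p` and the **block
minima** those with `prd p ≥ p`. The **depth** of a site `j` — the number of blocks `{b ≤ j ≤ max}`
spanning it — is `#{minima ≤ j} - #{maxima < j}` (**`card_spans_eq`**), and the successor is recovered
from minima, maxima and depth: for a non-maximum `p`, `nxt p` is the first site after `p` of depth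
`≤ depth p` (**`depth_lt_of_mem_cyc`**, **`depth_nxt`**); for a maximum, `nxt p` (the minimum of the
block) is the last minimum `≤ p` of depth `≤ depth p` (**`depth_nxt_of_max`**, **`depth_lt_of_min`**).
Consequently **two states with the same minima and maxima are equal** (**`eq_of_minmax_eq`**): the
thickened Dyck path determines the non-crossing partition. This is the injectivity input of the vertex
embedding of the connectivity basis.

## References

* Y. Ikhlef, A. K. Ponsaing, *Finite-size left-passage probability in percolation*, J. Stat. Phys.
  149 (2012) 10–36, arXiv:1202.5476, §3.1. [IkhlefPonsaing2012]
-/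

namespace Literature.Probability.Percolation

open Finset Literature.Probability.LatticeModels.TemperleyLieb

variable {n : ℕ} (s : NCState n)

/-! ### Minima, maxima, and the pairing `prd : minima ≃ maxima` -/

section MinMax

/-- `p` is the maximum of its block. [folklore] -/
def IsBMax (p : Fin n) : Prop := ¬p < nxt s p

/-- `p` is the minimum of its block. [folklore] -/
def IsBMin (p : Fin n) : Prop := ¬prd s p < p

/-- Being a block maximum is decidable. [folklore] -/
instance (p : Fin n) : Decidable (IsBMax s p) := by unfold IsBMax; infer_instance
/-- Being a block minimum is decidable. [folklore] -/
instance (p : Fin n) : Decidable (IsBMin s p) := by unfold IsBMin; infer_instance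

/-- The successor of a maximum is a minimum. [folklore] -/
theorem isBMin_nxt_of_isBMax {p : Fin n} (h : IsBMax s p) : IsBMin s (nxt s p) := by
  unfold IsBMin; rw [prd_nxt]; exact h

/-- The predecessor of a minimum is a maximum. [folklore] -/
theorem isBMax_prd_of_isBMin {p : Fin n} (h : IsBMin s p) : IsBMax s (prd s p) := by
  unfold IsBMax; rw [nxt_prd]; exact h

/-- **No related site lies strictly between... a block element and the maximum above**: if `b ~ c`,
`b ≤ p ≤ c`... The basic crossing exclusion used below: chords `(b, prd b)` of minima do not cross
`(p, nxt p)`. [folklore] -/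
theorem rel_prd_min {b : Fin n} (_hb : IsBMin s b) : s.1 b (prd s b) = true := rel_prd s b

end MinMax

/-! ### The spanning blocks and the depth -/

section Depth

/-- The minima whose block spans `j`: `b ≤ j ≤ prd b`. [folklore] -/
def spans (j : Fin n) : Finset (Fin n) := univ.filter fun b => IsBMin s b ∧ b ≤ j ∧ j ≤ prd s b

/-- Membership in `spans`. [folklore] -/
@[simp] theorem mem_spans {j b : Fin n} : b ∈ spans s j ↔ IsBMin s b ∧ b ≤ j ∧ j ≤ prd s b := by simp [spans]

/-- **The depth** of `j`: the number of blocks spanning it. [folklore] -/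
def depth (j : Fin n) : ℕ := (spans s j).card

/-- **The depth through minima and maxima**: `#{minima ≤ j} = depth j + #{maxima < j}`. [folklore] -/
theorem card_spans_eq (j : Fin n) :
    (univ.filter fun b => IsBMin s b ∧ b ≤ j).card = depth s j + (univ.filter fun c => IsBMax s c ∧ c < j).card := by
  have hsplit : (univ.filter fun b => IsBMin s b ∧ b ≤ j) =
      spans s j ∪ (univ.filter fun b => IsBMin s b ∧ b ≤ j ∧ prd s b < j) := by
    ext b; simp only [mem_filter, mem_univ, true_and, mem_union, mem_spans]
    constructor
    · rintro ⟨h1, h2⟩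
      by_cases h : j ≤ prd s b
      · exact Or.inl ⟨h1, h2, h⟩
      · exact Or.inr ⟨h1, h2, not_le.1 h⟩
    · rintro (⟨h1, h2, -⟩ | ⟨h1, h2, -⟩) <;> exact ⟨h1, h2⟩
  have hdisj : Disjoint (spans s j) (univ.filter fun b => IsBMin s b ∧ b ≤ j ∧ prd s b < j) := by
    rw [disjoint_left]; intro b h1 h2
    rw [mem_spans] at h1; simp only [mem_filter, mem_univ, true_and] at h2
    exact absurd h1.2.2 (not_le.2 h2.2.2)
  rw [hsplit, card_union_of_disjoint hdisj, depth]
  congr 1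
  -- the bijection `b ↦ prd b` onto the maxima below `j`
  refine card_bij (fun b _ => prd s b) (fun b hb => ?_) (fun b₁ h₁ b₂ h₂ h => ?_) (fun c hc => ?_)
  · simp only [mem_filter, mem_univ, true_and] at hb ⊢
    exact ⟨isBMax_prd_of_isBMin s hb.1, hb.2.2⟩
  · have := congrArg (nxt s) h; rwa [nxt_prd, nxt_prd] at this
  · simp only [mem_filter, mem_univ, true_and] at hc
    refine ⟨nxt s c, ?_, prd_nxt s c⟩
    simp only [mem_filter, mem_univ, true_and]
    refine ⟨isBMin_nxt_of_isBMax s hc.1, ?_, by rw [prd_nxt]; exact hc.2⟩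
    exact le_trans (not_lt.1 hc.1) hc.2.le

variable {s}

/-- The crossing exclusion: a minimum `b` with `b < p < prd b < l` and `p ~ l` is impossible unless `b ~ p`. [folklore] -/
theorem min_chord_cross {b p l : Fin n} (hbp : b < p) (hpc : p < prd s b) (hcl : prd s b < l) (hpl : s.1 p l = true)
    (hnot : s.1 b p ≠ true) : False :=
  nc_cross s.2 hbp hpc hcl (rel_prd s b) hpl hnot

/-- `nxt p` is in the block, so the maximum `prd b` of a spanning block of the same class is `≥ nxt p`:
elements of the block of `p` lie in `[b, prd b]` for the minimum `b` of that block. Here: if `b ~ p` is a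
minimum then every `l ~ p` satisfies `l ≤ prd b`. [folklore] -/
theorem le_prd_of_rel_min {b p l : Fin n} (hb : IsBMin s b) (hbp : s.1 b p = true) (hpl : s.1 p l = true) : l ≤ prd s b := by
  by_contra h
  rw [not_le] at h
  -- `l` related to `b`, `l > prd b`: `l ∈ cyc(prd b, b)` contradicts the predecessor property
  have hbl : s.1 b l = true := s.2.trans _ _ _ hbp hpl
  refine not_rel_of_cyc_prd s b l ?_ hbl
  unfold cyc; unfold IsBMin at hb
  rw [if_neg hb]
  exact Or.inl h

/-- Every element related to a minimum `b` is `≥ b`. [folklore] -/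
theorem min_le_of_rel {b l : Fin n} (hb : IsBMin s b) (hbl : s.1 b l = true) : b ≤ l := by
  by_contra h
  rw [not_le] at h
  refine not_rel_of_cyc_prd s b l ?_ hbl
  unfold cyc; unfold IsBMin at hb
  rw [if_neg hb]
  exact Or.inr h

end Depth

/-! ### The minimum of a block -/

section BMin

/-- The minimum of the block of `j`. [folklore] -/
def bmin (j : Fin n) : Fin n := (ncBlk s j).min' ⟨j, mem_ncBlk_self s j⟩

/-- The minimum is related. [folklore] -/
theorem rel_bmin (j : Fin n) : s.1 j (bmin s j) = true := by
  have := min'_mem (ncBlk s j) ⟨j, mem_ncBlk_self s j⟩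
  unfold ncBlk at this; rw [mem_filter] at this; exact this.2

/-- The minimum is below. [folklore] -/
theorem bmin_le (j : Fin n) : bmin s j ≤ j := min'_le _ _ (mem_ncBlk_self s j)

/-- The minimum is a block minimum. [folklore] -/
theorem isBMin_bmin (j : Fin n) : IsBMin s (bmin s j) := by
  unfold IsBMin; intro h
  have hmem : prd s (bmin s j) ∈ ncBlk s j := by
    unfold ncBlk; rw [mem_filter]
    exact ⟨mem_univ _, s.2.trans _ _ _ (rel_bmin s j) (rel_prd s _)⟩
  exact absurd (min'_le (ncBlk s j) _ hmem) (not_le.2 h)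

/-- `j` is spanned by the block of its minimum: `j ≤ prd (bmin j)`. [folklore] -/
theorem le_prd_bmin (j : Fin n) : j ≤ prd s (bmin s j) :=
  le_prd_of_rel_min (isBMin_bmin s j) (s.2.symm _ _ (rel_bmin s j)) (s.2.refl j)

/-- The minimum of the block of a minimum is itself. [folklore] -/
theorem bmin_of_isBMin {b : Fin n} (hb : IsBMin s b) : bmin s b = b :=
  le_antisymm (bmin_le s b) (min_le_of_rel hb (rel_bmin s b))

end BMin

/-! ### The depth along a block -/

section DepthLemmas

variable {s}

/-- **The depth increases strictly inside the arc of a non-maximum**: `p < j < nxt p ⇒ depth p < depth j`. [folklore] -/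
theorem depth_lt_of_mem_cyc {p j : Fin n} (hp : p < nxt s p) (hpj : p < j) (hjn : j < nxt s p) : depth s p < depth s j := by
  have hnotrel : s.1 p j ≠ true := not_rel_of_cyc_nxt s p j (by unfold cyc; rw [if_pos hp]; exact ⟨hpj, hjn⟩)
  unfold depth
  refine card_lt_card ⟨fun b hb => ?_, fun hsub => ?_⟩
  · rw [mem_spans] at hb ⊢
    obtain ⟨hmin, hbp, hpc⟩ := hb
    refine ⟨hmin, le_trans hbp hpj.le, ?_⟩
    by_contra hc
    rw [not_le] at hc
    -- `b ≤ p ≤ prd b < j < nxt p`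
    by_cases hbp' : s.1 b p = true
    · exact absurd (le_prd_of_rel_min hmin hbp' (rel_nxt s p)) (not_le.2 (lt_trans hc hjn))
    · have hbne : b ≠ p := fun h => hbp' (by rw [h]; exact s.2.refl p)
      have hcne : prd s b ≠ p := fun h => hbp' (by rw [← h]; exact rel_prd s b)
      exact min_chord_cross (lt_of_le_of_ne hbp hbne) (lt_of_le_of_ne hpc (Ne.symm hcne)) (lt_trans hc hjn) (rel_nxt s p) hbp'
  · -- the block of `j` spans `j` but not `p`
    have hmem : bmin s j ∈ spans s j := (mem_spans s).2 ⟨isBMin_bmin s j, bmin_le s j, le_prd_bmin s j⟩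
    have := (mem_spans s).1 (hsub hmem)
    obtain ⟨-, hbp, hpc⟩ := this
    -- `bmin j ≤ p`: `bmin j ≠ p` (else `p ~ j`), so `bmin j < p < j ≤ prd (bmin j)` and ... `j ~ bmin j`, crossing with `(p, nxt p)`
    have hne : bmin s j ≠ p := fun h => hnotrel (by rw [← h]; exact s.2.symm _ _ (rel_bmin s j))
    have hlt : bmin s j < p := lt_of_le_of_ne hbp hne
    exact nc_cross s.2 hlt hpj hjn (s.2.symm _ _ (rel_bmin s j)) (rel_nxt s p) (fun h => hnotrel (s.2.trans _ _ _ (s.2.symm _ _ h) (s.2.symm _ _ (rel_bmin s j))))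

/-- **The depth at the successor of a non-maximum equals the depth.** [folklore] -/
theorem depth_nxt {p : Fin n} (hp : p < nxt s p) : depth s (nxt s p) = depth s p := by
  unfold depth; congr 1; ext b; rw [mem_spans, mem_spans]
  constructor
  · rintro ⟨hmin, hbn, hnc⟩
    refine ⟨hmin, ?_, le_trans hp.le hnc⟩
    by_contra hbp; rw [not_le] at hbp
    -- `p < b ≤ nxt p ≤ prd b`; `b ≠ nxt p` (a minimum with `prd = p < b`? no: `prd (nxt p) = p < nxt p`)
    have hbne : b ≠ nxt s p := fun h => by
      unfold IsBMin at hmin; rw [h, prd_nxt] at hmin; exact hmin hp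
    have hblt : b < nxt s p := lt_of_le_of_ne hbn hbne
    have hnotrel : s.1 p b ≠ true := not_rel_of_cyc_nxt s p b (by unfold cyc; rw [if_pos hp]; exact ⟨hbp, hblt⟩)
    have hcne : prd s b ≠ nxt s p := fun h => hnotrel (by
      have : s.1 b (nxt s p) = true := by rw [← h]; exact rel_prd s b
      exact s.2.symm _ _ (s.2.trans _ _ _ this (s.2.symm _ _ (rel_nxt s p))))
    exact nc_cross s.2 hbp hblt (lt_of_le_of_ne hnc (Ne.symm hcne)) (rel_nxt s p) (rel_prd s b) hnotrel
  · rintro ⟨hmin, hbp, hpc⟩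
    refine ⟨hmin, le_trans hbp hp.le, ?_⟩
    by_contra hc; rw [not_le] at hc
    by_cases hbp' : s.1 b p = true
    · exact absurd (le_prd_of_rel_min hmin hbp' (rel_nxt s p)) (not_le.2 hc)
    · have hbne : b ≠ p := fun h => hbp' (by rw [h]; exact s.2.refl p)
      have hcne : prd s b ≠ p := fun h => hbp' (by rw [← h]; exact rel_prd s b)
      exact min_chord_cross (lt_of_le_of_ne hbp hbne) (lt_of_le_of_ne hpc (Ne.symm hcne)) hc (rel_nxt s p) hbp'

/-- **The depth at the successor (= block minimum) of a maximum equals the depth.** [folklore] -/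
theorem depth_nxt_of_max {p : Fin n} (hp : IsBMax s p) : depth s (nxt s p) = depth s p := by
  have hle : nxt s p ≤ p := not_lt.1 hp
  rcases hle.eq_or_lt with he | hlt
  · rw [he]
  have hmin0 : IsBMin s (nxt s p) := isBMin_nxt_of_isBMax s hp
  unfold depth; congr 1; ext b; rw [mem_spans, mem_spans]
  constructor
  · rintro ⟨hmin, hbn, hnc⟩
    refine ⟨hmin, le_trans hbn hle, ?_⟩
    by_contra hc; rw [not_le] at hc
    by_cases hb0 : s.1 b (nxt s p) = true
    · -- same block: `prd b ≥ p`
      exact absurd (le_prd_of_rel_min hmin hb0 (s.2.symm _ _ (rel_nxt s p))) (not_le.2 hc)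
    · have hbne : b ≠ nxt s p := fun h => hb0 (by rw [h]; exact s.2.refl _)
      have hcne : prd s b ≠ nxt s p := fun h => hb0 (by rw [← h]; exact rel_prd s b)
      -- `b < nxt p < prd b < p`: chords `(b, prd b)` and `(nxt p, p)`
      exact nc_cross s.2 (lt_of_le_of_ne hbn hbne) (lt_of_le_of_ne hnc (Ne.symm hcne)) hc (rel_prd s b)
        (s.2.symm _ _ (rel_nxt s p)) hb0
  · rintro ⟨hmin, hbp, hpc⟩
    refine ⟨hmin, ?_, le_trans hlt.le hpc⟩
    by_contra hb0; rw [not_le] at hb0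
    -- `nxt p < b ≤ p ≤ prd b`; `b ~ p` would make `b` the minimum of the block of `p`, i.e. `nxt p`
    by_cases hbp' : s.1 b p = true
    · have : b ≤ nxt s p := min_le_of_rel hmin (s.2.trans _ _ _ hbp' (rel_nxt s p))
      exact absurd this (not_le.2 hb0)
    · have hbne : b ≠ p := fun h => hbp' (by rw [h]; exact s.2.refl p)
      have hcne : prd s b ≠ p := fun h => hbp' (by rw [← h]; exact rel_prd s b)
      -- `nxt p < b < p < prd b`: chords `(nxt p, p)` and `(b, prd b)`
      exact nc_cross s.2 hb0 (lt_of_le_of_ne hbp hbne) (lt_of_le_of_ne hpc (Ne.symm hcne)) (s.2.symm _ _ (rel_nxt s p))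
        (rel_prd s b) (fun h => hbp' (s.2.trans _ _ _ (s.2.symm _ _ h) (s.2.symm _ _ (rel_nxt s p))))

/-- **The depth at the other minima in the block span of a maximum is larger.** [folklore] -/
theorem depth_lt_of_min {p j : Fin n} (hp : IsBMax s p) (hj : IsBMin s j) (h0j : nxt s p < j) (hjp : j ≤ p) :
    depth s p < depth s j := by
  have hmin0 : IsBMin s (nxt s p) := isBMin_nxt_of_isBMax s hp
  -- `j` is not in the block of `p`
  have hjp' : s.1 j p ≠ true := fun h => by
    have : j ≤ nxt s p := min_le_of_rel hj (s.2.trans _ _ _ h (rel_nxt s p))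
    exact absurd this (not_le.2 h0j)
  have hjne : j ≠ p := fun h => hjp' (by rw [h]; exact s.2.refl p)
  have hjlt : j < p := lt_of_le_of_ne hjp hjne
  unfold depth
  refine card_lt_card ⟨fun b hb => ?_, fun hsub => ?_⟩
  · rw [mem_spans] at hb ⊢
    obtain ⟨hmin, hbp, hpc⟩ := hb
    refine ⟨hmin, ?_, le_trans hjp hpc⟩
    by_contra hjb; rw [not_le] at hjb
    -- `nxt p < j < b ≤ p ≤ prd b`, `b ≁ p` (else `b = nxt p`)
    by_cases hbp' : s.1 b p = true
    · have : b ≤ nxt s p := min_le_of_rel hmin (s.2.trans _ _ _ hbp' (rel_nxt s p))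
      exact absurd (lt_of_le_of_lt this (lt_trans h0j hjb)) (lt_irrefl _)
    · have hbne : b ≠ p := fun h => hbp' (by rw [h]; exact s.2.refl p)
      have hcne : prd s b ≠ p := fun h => hbp' (by rw [← h]; exact rel_prd s b)
      exact nc_cross s.2 (lt_trans h0j hjb) (lt_of_le_of_ne hbp hbne) (lt_of_le_of_ne hpc (Ne.symm hcne))
        (s.2.symm _ _ (rel_nxt s p)) (rel_prd s b) (fun h => hbp' (s.2.trans _ _ _ (s.2.symm _ _ h) (s.2.symm _ _ (rel_nxt s p))))
  · -- `j` spans itself but not `p`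
    have hmem : j ∈ spans s j := (mem_spans s).2 ⟨hj, le_rfl, not_lt.1 hj⟩
    obtain ⟨-, -, hpc⟩ := (mem_spans s).1 (hsub hmem)
    have hcne : prd s j ≠ p := fun h => hjp' (by rw [← h]; exact rel_prd s j)
    -- `nxt p < j < p < prd j`
    exact nc_cross s.2 h0j hjlt (lt_of_le_of_ne hpc (Ne.symm hcne)) (s.2.symm _ _ (rel_nxt s p)) (rel_prd s j) (fun h => hjp'
      (s.2.trans _ _ _ (s.2.symm _ _ h) (s.2.symm _ _ (rel_nxt s p))))

end DepthLemmas

/-! ### The successor from minima, maxima and depth; the orbit of the successor -/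

section Determined

variable {s} {s' : NCState n}

/-- **Two states with the same maxima, minima and depths have the same successor.** [folklore] -/
theorem nxt_eq_of_minmax_depth (hmax : ∀ p, IsBMax s p ↔ IsBMax s' p) (hmin : ∀ p, IsBMin s p ↔ IsBMin s' p)
    (hdep : ∀ p, depth s p = depth s' p) : nxt s = nxt s' := by
  funext p
  by_cases hp : IsBMax s p
  · have hp' : IsBMax s' p := (hmax p).1 hp
    -- both successors are minima `≤ p` of depth `= depth p`; the larger would have larger depth
    rcases lt_trichotomy (nxt s p) (nxt s' p) with h | h | h
    · exfalso
      have t := depth_lt_of_min (s := s) hp ((hmin _).2 (isBMin_nxt_of_isBMax s' hp')) h (not_lt.1 hp')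
      rw [hdep (nxt s' p), depth_nxt_of_max hp', ← hdep] at t
      exact lt_irrefl _ t
    · exact h
    · exfalso
      have t := depth_lt_of_min (s := s') hp' ((hmin _).1 (isBMin_nxt_of_isBMax s hp)) h (not_lt.1 hp)
      rw [← hdep (nxt s p), depth_nxt_of_max hp, hdep] at t
      exact lt_irrefl _ t
  · have hp' : ¬IsBMax s' p := fun h => hp ((hmax p).2 h)
    unfold IsBMax at hp hp'; push Not at hp hp'
    rcases lt_trichotomy (nxt s p) (nxt s' p) with h | h | h
    · exfalso
      have t := depth_lt_of_mem_cyc (s := s') hp' hp h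
      rw [← hdep, ← hdep, depth_nxt hp] at t
      exact lt_irrefl _ t
    · exact h
    · exfalso
      have t := depth_lt_of_mem_cyc (s := s) hp hp' h
      rw [hdep, hdep, depth_nxt hp'] at t
      exact lt_irrefl _ t

variable (s)

/-- Some iterate of the successor returns to the start. [folklore] -/
theorem exists_iterate_nxt_eq_self (p : Fin n) : ∃ d, 0 < d ∧ d ≤ n ∧ (nxt s)^[d] p = p := by
  -- pigeonhole among `nxt^[0] p, …, nxt^[n] p`
  obtain ⟨a, ha, b, hb, hne, hab⟩ : ∃ a ∈ range (n + 1), ∃ b ∈ range (n + 1), a ≠ b ∧ (nxt s)^[a] p = (nxt s)^[b] p := by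
    by_contra h
    push Not at h
    have hinj : Set.InjOn (fun k => (nxt s)^[k] p) (range (n + 1) : Finset ℕ) := fun a ha b hb hab => by
      by_contra hne; exact h a ha b hb hne hab
    have := card_le_card_of_injOn (fun k => (nxt s)^[k] p) (fun k _ => mem_univ _) hinj
    simp at this
  wlog hlt : a < b generalizing a b
  · exact this b hb a ha (Ne.symm hne) hab.symm (lt_of_le_of_ne (not_lt.1 hlt) (Ne.symm hne))
  refine ⟨b - a, by omega, by simp at hb; omega, ?_⟩
  have hinj := Function.Injective.iterate (nxt_injective s) a
  apply hinj
  rw [← Function.iterate_add_apply, Nat.add_sub_cancel' hlt.le]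
  exact hab.symm

/-- Iterates of the successor are related. [folklore] -/
theorem rel_iterate_nxt (p : Fin n) (k : ℕ) : s.1 p ((nxt s)^[k] p) = true := by
  induction k with
  | zero => exact s.2.refl p
  | succ k ih => rw [Function.iterate_succ_apply']; exact s.2.trans _ _ _ ih (rel_nxt s _)

/-- **Related sites are iterated successors** (the blocks are the orbits of `nxt`). [folklore] -/
theorem exists_iterate_nxt_eq_of_rel {p j : Fin n} (hpj : s.1 p j = true) : ∃ k, (nxt s)^[k] p = j := by
  classical
  by_contra hno
  push Not at hno
  obtain ⟨d, hd0, -, hd⟩ := exists_iterate_nxt_eq_self s p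
  -- the orbit
  set O : Finset (Fin n) := (range d).image fun k => (nxt s)^[k] p with hO
  have hOmem : ∀ o ∈ O, ∃ k, (nxt s)^[k] p = o := fun o ho => by
    obtain ⟨k, -, rfl⟩ := mem_image.1 ho; exact ⟨k, rfl⟩
  have hOnxt : ∀ o ∈ O, nxt s o ∈ O := fun o ho => by
    obtain ⟨k, hk, rfl⟩ := mem_image.1 ho
    rw [mem_range] at hk
    have e : nxt s ((nxt s)^[k] p) = (nxt s)^[k + 1] p := (Function.iterate_succ_apply' (nxt s) k p).symm
    rw [e]
    by_cases h : k + 1 < d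
    · exact mem_image.2 ⟨k + 1, mem_range.2 h, rfl⟩
    · have : k + 1 = d := by omega
      rw [this, hd]; exact mem_image.2 ⟨0, mem_range.2 hd0, rfl⟩
  have hpO : p ∈ O := mem_image.2 ⟨0, mem_range.2 hd0, rfl⟩
  have hjO : j ∉ O := fun h => by obtain ⟨k, hk⟩ := hOmem j h; exact hno k hk
  have hOrel : ∀ o ∈ O, s.1 o j = true := fun o ho => by
    obtain ⟨k, rfl⟩ := hOmem o ho
    exact s.2.trans _ _ _ (s.2.symm _ _ (rel_iterate_nxt s p k)) hpj
  -- the orbit element cyclically just before `j`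
  let key : Fin n → ℕ := fun o => if o < j then o.val + n else o.val
  obtain ⟨o, hoO, homax⟩ := exists_max_image O key ⟨p, hpO⟩
  have hoj : o ≠ j := fun h => hjO (h ▸ hoO)
  -- no orbit element in `cyc(o, j)`
  have hgap : ∀ o' ∈ O, ¬cyc o j o' := fun o' ho' hc => by
    have h1 := homax o' ho'
    have hv := o.isLt; have hv' := o'.isLt
    simp only [key] at h1
    unfold cyc at hc
    split_ifs at hc h1 with ha hb hb' <;> rw [Fin.lt_def] at * <;> omega
  -- `nxt o` is an orbit element other than `j`; if `nxt o = o` the block is `{o}` and `j ~ o` is absurd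
  by_cases hno' : nxt s o = o
  · have : ¬∃ j', j' ≠ o ∧ s.1 o j' = true := fun h => ((nxt_ne_self_iff s o).2 h) hno'
    exact this ⟨j, Ne.symm hoj, hOrel o hoO⟩
  · have hnj : j ≠ nxt s o := fun h => hjO (h ▸ hOnxt o hoO)
    rcases cyc_total (Ne.symm hoj) hno' hnj with h | h
    · exact not_rel_of_cyc_nxt s o j h (hOrel o hoO)
    · exact hgap _ (hOnxt o hoO) h

/-- **A state is determined by its successor function.** [folklore] -/
theorem eq_of_nxt_eq (h : nxt s = nxt s') : s = s' := by
  apply Subtype.ext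
  funext p j
  apply Bool.eq_iff_iff.2
  constructor
  · intro hpj
    obtain ⟨k, rfl⟩ := exists_iterate_nxt_eq_of_rel s hpj
    rw [h]; exact rel_iterate_nxt s' p k
  · intro hpj
    obtain ⟨k, rfl⟩ := exists_iterate_nxt_eq_of_rel s' hpj
    rw [← h]; exact rel_iterate_nxt s p k

/-- **A non-crossing state is determined by its block minima and maxima** (its thickened Dyck path). [folklore] -/
theorem eq_of_minmax_eq (hmax : ∀ p, IsBMax s p ↔ IsBMax s' p) (hmin : ∀ p, IsBMin s p ↔ IsBMin s' p) : s = s' := by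
  refine eq_of_nxt_eq s (nxt_eq_of_minmax_depth hmax hmin fun p => ?_)
  have h1 := card_spans_eq s p
  have h2 := card_spans_eq s' p
  have e1 : (univ.filter fun b => IsBMin s b ∧ b ≤ p) = univ.filter fun b => IsBMin s' b ∧ b ≤ p :=
    filter_congr fun b _ => by rw [hmin]
  have e2 : (univ.filter fun c => IsBMax s c ∧ c < p) = univ.filter fun c => IsBMax s' c ∧ c < p :=
    filter_congr fun c _ => by rw [hmax]
  rw [e1, e2, h2] at h1
  omega

end Determined

end Literature.Probability.Percolation
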